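/-
Copyright: lit-balaban Phase-2 proof seat p02 (gen 12).  Statement-level skeleton of a published paper; no proof claims beyond what
the kernel checks below.
-/
import Literature.MathematicalPhysics.QuantumFieldTheory.BalabanImbrieJaffe1984to88.BIJ88OpCloseDkLocGradTorus
import Literature.MathematicalPhysics.QuantumFieldTheory.BalabanImbrieJaffe1984to88.BIJ85Eq531Proof

/-!
# `BalabanImbrieJaffe1984to88.BIJ88W1Prime543Torus` — T. Bałaban, J. Imbrie, A. Jaffe, *Effective action and cluster properties of the
abelian Higgs model*, Commun. Math. Phys. **114** (1988) 257–315 [BalabanImbrieJaffe1988], §5.4 p. 282 [PDF 26]: **the tail kernel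
`w′₁ = (𝒟_k − 𝒟_{k,loc})∂*Q^{e*}_k∂□` of (5.4.3) ON THE TORI OF THE SERIES FOR THE KERNELS OF RECORD — DEFINITION WITH BODY, THE RANGE
CLAUSE «w′₁ = w′₁□», AND THE EXACT REDUCTION `w′₁(b, b′) = Σ_{p′} (∂□e_{b′})(p′)·Σ_{j<k} T_j(b, p′)`** in which `∂^{η*}` and `Q^{e*}_k` are
moved onto the right factor of every tail of (2.12) and the three weights cancel exactly (`η_k^d·L^{2k}·(L^k)^{−(d−2)} = 1`):
`T_j(b, p′) = Σ_{b₁,b₂}[H_j(b,b₁)C^{(j),L^jη}(b₁,b₂)(Q^e_k∂^ηH_j(·,b₂))(p′) − H_{j,loc}(b,b₁)C^{(j),L^jη}_{loc}(b₁,b₂)(Q^e_k∂^ηH_{j,loc}(·,b₂))(p′)]`.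
This is file 1 of the p02 programme for r16's flip condition of row C2.Eq5.4.7 (the p. 282 bounds for `w′₁`, `w₁` on the tori); the
per-scale bound, the resummation over `j` and r16's `Ineq547` instance are the sequel (`BIJ88W1Prime543Bound`).

statement-level skeleton of published theorems with citation tags; proofs where landed; nothing here is a claim about the Yang–Mills mass gap

PDF held: `paper:balaban1988-cmp114-bij-abelian-higgs-effective-action` (journal page = PDF page + 256).  Page read this session AS AN IMAGE:
p. 282 [PDF 26] (`HOME/lit-balaban-r16/renders/cmp114/original-p026-x2.png`); text layer p0026.txt (formulas garbled there).

CITATION HEADER (lean-in-tree rule).  Part of the lit-balaban TYPED SKELETON (HOME `run/shared/lean/pub/lit-balaban/`), Phase-2 proof seat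
p02 (gen 12), unit `lit-balaban-p02`; free-target protocol G.5-34(d), TAKING line HOME/STATUS.md 2026-08-22T02:38Z.  WHAT IS REPRODUCED =
SKELETON row **C2.Eq5.4.7** (owner r16 `lit-balaban-r16/ROWS-C2-part2.md`, referee ref-5), the kernel `w′₁` of (5.4.3) p. 282, kind «model
instance for the kernels of record» (r16's v2.60/v2.69 flip condition «w′₁ tails composition»).  Decls of record used BY NAME (nothing
restated): p11's `DkE` ((I.4.4.4) propagator) and `toE`; r18's `BIJ88CurlyDkLocTorus.dkLocKer`/`hKer`/`hlKer`/`cKer`/`clKer` ((2.12), (2.4),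
(2.8)–(2.9) on the torus) and `BIJ88CurlyDkLocCloseTorus.dk_sub_dkLoc_eq_sum`; p08's operator convention `BIJ88Sect2Statements.applyK` with the
`η^d`-weighted kernel (`BIJ88OpCloseDkLocTorus`); BIJ85Eq531Proof's `plaqDiv` (`∂^*`, the transpose of `LatticeFieldCalculus.curl`) and
`sum_curl_mul`; p31's `BIJ85Eq224Base0.torusEdgeCellsTo` (the `k`-fold edge-plaquette geometry) with BIJ85CellAverages' `Cells.Q`/`Cells.Qstar`
((I.2.21)–(I.2.24)) and `inner_Q_eq_inner_Qstar`.

THE PRINTED TEXT (p. 282 [PDF 26], read as an image, verbatim): *"We now write (Q^{s*}_k − 𝒟_{k,loc}∂*Q^{e*}_k∂)□A′ = (Q^{s*}_k − 𝒟_kQ^{e*}_k∂)□A′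
+ w′₁A′. (5.4.3) The kernel w′₁ = (𝒟_k − 𝒟_{k,loc})∂*Q^{e*}_k∂□ involves only the tails not included in the expansion (2.12). Using the regularity
and exponential decay of H_j, H_{j,loc}, along with (2.7) and scaling properties of these kernels, we find that |(∂w′₁)(p,b′)| ≦ Σ_{j=1}^{k−1}
(L^jη)^{−1−(d−2)−1+(d−2)}e^{−cr(e_j)}e^{−c dist(p,b′)} ≦ e^{−cr(e_k)}e^{−c dist(p,b′)}, and similarly for w′₁, ∂*w′₁. Also, w′₁ is finite ranged
in the sense that w′₁ = w′₁□; we use w′₁(b,b′) only for b in □₀ ⊂ □. … We have put w₁ = w′₁ + H_k□ − H_{k,loc}, and it satisfies the same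
bounds as w′₁."*  (Reading note: the right member of (5.4.3) prints `𝒟_kQ^{e*}_k∂` without the `∂*` of the left member and of the kernel
sentence; the kernel sentence is the one typed — HOME/GAPS.md G-C2-21.)

THE READING (objects of record; `U = 1`, real abelian fields, torus `T_η`, `η = L^{−k}`, standing range `k ≤ m + K`, `d ≥ 2`).
* `𝒟_k − 𝒟_{k,loc}` = p08's `η_k^d`-weighted kernel `kdiff ρ k b b″ = η_k^d(𝒟_k(b,b″) − 𝒟_{k,loc}(b,b″))` (`DkE` at `(η_k^d, L^k)`, r18's
  `dkLocKer` with the radius schedule `ρ`), acting by `applyK` — exactly the operator of `BIJ88OpCloseDkLocTorus`.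
* `□A′` = multiplication of the unit 1-form `A′` by a cube function `χ : T₁^{(k)}-bonds → ℝ` (an indicator in print); the column at `b′` is
  `boxSingle χ b′ = □e_{b′}`.
* `∂` = the unit-lattice curl `curl 1` (`T₁^{(k)}` has spacing 1 at step `k`); `Q^{e*}_k` = `(edgeGeo P hd k).Qstar`, the adjoint of the `k`-fold
  edge average for the pairings `⟨·,·⟩_η` (fine plaquettes, weight `η^d`) and `⟨·,·⟩₁` (unit plaquettes): value `L^{2k}g(p′)` on `B^e_k(p′)`
  ((I.2.22)/(I.2.24)); `∂*` = `∂^{η*}` = `plaqDiv (L^k)`, the transpose of `∂^η = curl (L^k)` (both fine pairings carry the same weight `η^d`).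
* `w′₁(b, b′) := ((𝒟_k − 𝒟_{k,loc})(∂^{η*}Q^{e*}_k∂□e_{b′}))(b)` = `w1P hd ρ k χ b b′`, `b` an `η`-bond, `b′` a unit bond.

WHAT IS PROVED (0 `sorry`, standard axioms; definitions with bodies + theorems):
* §1 RANGE CLAUSE **`w1P_eq_zero_of_chi`** («w′₁ = w′₁□»: `χ(b′) = 0 ⟹ w′₁(·, b′) = 0`, via `rcol_eq_zero_of_chi`); the coarse curl of `□e_{b′}`:
  `abs_curl_boxSingle_le` (`≤ 4|χ(b′)|`), `curl_boxSingle_eq_zero` (vanishes unless `b′` is an edge of `p′`), the incidence counts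
  `card_slot1_le` … `card_slot4_le` (`≤ d` each) and **`sum_abs_curl_boxSingle_mul_le`** (`Σ_{p′}|(∂□e_{b′})(p′)|w(p′) ≤ 4d|χ(b′)|W`).
* §2 `qcurl` (`A ↦ (Q^e_k∂^ηA)(p′)` as a linear functional), `dcol_eq_sum` (the row of `𝒟_k − 𝒟_{k,loc}` as a linear combination of the columns
  `H_j(·,b₂)`, `H_{j,loc}(·,b₂)`), **`qcurl_dcol_eq_sum_tT`** (`(Q^e_k∂^η[(𝒟_k − 𝒟_{k,loc})(b,·)])(p′) = Σ_{j<k}T_j(b,p′)`).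
* §3 **`eta_pow_mul_L_pow`** (`η_k^d(L^k)^d = 1`), `w1P_eq_weighted_sum`, `sum_dcol_rcol_eq` (`∂^{η*}` onto the kernel), `sum_mul_Qstar_eq`
  (`Q^{e*}_k` onto the kernel), **`w1P_eq_sum`** (THE REDUCTION), **`abs_w1P_le_sum`**, and the face forms `gT_eq_face_sum`, `glT_eq_face_sum`,
  **`tT_eq_face_sum`** (`T_j(b,p′) = (L^k)^{−(d−2)}Σ_{p∈B^e_k(p′)}Σ_{b₁,b₂}[H_jC^{(j)}(∂^ηH_j(·,b₂))(p) − loc]`).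
HONEST SCOPE.  (i) Definitions + algebra only: no estimate here (the per-scale bound `|T_j| ≲ (L^{k−j})^{d−1}e^{−cρ_j}e^{−c dist}`, the resummation
and the `Ineq547` instances for `w′₁`, `w₁` are the sequel).  (ii) The READING above is the model instance: `□` as a bond function, `∂*`/`Q^{e*}_k`
as the adjoints for the printed pairings, p08's `η^d` operator convention; the print's `A′`-level identity (5.4.3) itself (with `Q^{s*}_k`) is not
restated — only its kernel `w′₁`.  (iii) `U = 1`, real abelian fields, torus, standing range; `2 ≤ d`.  (iv) No new named fact (no `def … : Prop`);
NOT summit progress.  Unit `lit-balaban-p02` (literature-prover-lit-balaban-p02-g12-0), 2026-08-22.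
-/

open scoped BigOperators RealInnerProductSpace

namespace Literature.MathematicalPhysics.QuantumFieldTheory.BalabanImbrieJaffe1984to88.BIJ88W1Prime543Torus

open Balaban1983to89 hiding Site Plaq
open Balaban1983to89.LatticeFieldCalculus
open BIJ85AxialPropagator411 (toE)
open BIJ85Prop521Torus BIJ85Prop522Torus BIJ85Sigma422Eta
open BIJ85Sect7Statements BIJ85Ineq722Torus
open BIJ85CellAverages
open BIJ85Eq224Base0 (torusEdgeCellsTo card_edgeBTo)
open BIJ85Eq531Proof (plaqDiv sum_curl_mul)
open BIJ88Sect2Statements (applyK)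
open BIJ88CurlyDkLocTorus
open BIJ88CurlyDkLocCloseTorus (dk_sub_dkLoc_eq_sum)
-- inside this namespace the bare `Site`/`Plaq` are the `ℤ^d` carriers of the QFT root; the torus ones are renamed:
open Balaban1983to89 renaming Site → TSite, Plaq → TPlaq

noncomputable section

variable {P : Params}

/-- the `k`-fold edge-plaquette geometry of record between `T_η` and `T₁^{(k)}` (p31's `torusEdgeCellsTo P 0 k k`): its `Q`, `Qstar` are
`Q^e_k`, `Q^{e*}_k` of (I.2.24). [cite: BalabanImbrieJaffe1985, (2.24) p.305] -/
abbrev edgeGeo (P : Params) (hd : 2 ≤ P.d) (k : ℕ) : Cells := torusEdgeCellsTo P 0 k k (Nat.zero_add k) hd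

/-- the coarse 1-form `□e_{b′}` on `T₁^{(k)}`: the indicator of the unit bond `b′` weighted by the cube function `□ = χ`.
[cite: BalabanImbrieJaffe1988, (5.4.3) p.282] -/
def boxSingle {k : ℕ} (χ : PBond P k → ℝ) (b' : PBond P k) : PBond P k → ℝ := fun c => if c = b' then χ c else 0

/-- the column at `b′` of the local right factor `∂*Q^{e*}_k∂□` of (5.4.3): the fine 1-form `∂^{η*}Q^{e*}_k∂(□e_{b′})` on `T_η`
(`∂^{η*}` = `plaqDiv (L^k)`, `Q^{e*}_k` = `(edgeGeo P hd k).Qstar`, `∂` = `curl 1` on `T₁^{(k)}`). [cite: BalabanImbrieJaffe1988, (5.4.3) p.282] -/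
def rcol (hd : 2 ≤ P.d) (k : ℕ) (χ : PBond P k → ℝ) (b' : PBond P k) : PBond P 0 → ℝ :=
  plaqDiv ((P.L : ℝ) ^ k) ((edgeGeo P hd k).Qstar (curl 1 (boxSingle χ b')))

/-- the `η^d`-weighted kernel of `𝒟_k − 𝒟_{k,loc}` (p08's operator convention of `BIJ88OpCloseDkLocTorus`).
[cite: BalabanImbrieJaffe1988, (5.4.3) p.282] -/
def kdiff (ρ : ℕ → ℝ) (k : ℕ) (b b'' : PBond P 0) : ℝ :=
  (P.eta k) ^ P.d * (DkE P ((P.eta k) ^ P.d) ((P.L : ℝ) ^ k) k (toE P (Pi.single b'' 1)) b -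
    dkLocKer (P := P) ((P.eta k) ^ P.d) ((P.L : ℝ) ^ k) ρ k b b'')

/-- **`w′₁(b, b′)` ON THE TORUS** := `((𝒟_k − 𝒟_{k,loc})∂^{η*}Q^{e*}_k∂(□e_{b′}))(b)`. [cite: BalabanImbrieJaffe1988, (5.4.3) p.282] -/
def w1P (hd : 2 ≤ P.d) (ρ : ℕ → ℝ) (k : ℕ) (χ : PBond P k → ℝ) (b : PBond P 0) (b' : PBond P k) : ℝ :=
  applyK (kdiff ρ k) (rcol hd k χ b') b

/-- `G_j(b₂; p′) := (Q^e_k∂^ηH_j(·, b₂))(p′)`. [cite: BalabanImbrieJaffe1988, (5.4.3) p.282] -/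
def gT (hd : 2 ≤ P.d) (k j : ℕ) (b₂ : PBond P j) (p' : TPlaq P k) : ℝ :=
  (edgeGeo P hd k).Q (curl ((P.L : ℝ) ^ k) (fun b'' : PBond P 0 => hKer (P := P) ((P.eta k) ^ P.d) ((P.L : ℝ) ^ k) j b'' b₂)) p'

/-- `G_{j,loc}(b₂; p′) := (Q^e_k∂^ηH_{j,loc}(·, b₂))(p′)`. [cite: BalabanImbrieJaffe1988, (5.4.3) p.282] -/
def glT (hd : 2 ≤ P.d) (ρ : ℕ → ℝ) (k j : ℕ) (b₂ : PBond P j) (p' : TPlaq P k) : ℝ :=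
  (edgeGeo P hd k).Q (curl ((P.L : ℝ) ^ k)
    (fun b'' : PBond P 0 => hlKer (P := P) ((P.eta k) ^ P.d) ((P.L : ℝ) ^ k) (ρ j / 16) (ρ j / 8) j b'' b₂)) p'

/-- the scale-`j` dressed difference term `T_j(b, p′) := Σ_{b₁,b₂}[H_j(b,b₁)C^{(j)}(b₁,b₂)G_j(b₂;p′) − H_{j,loc}C^{(j)}_{loc}G_{j,loc}]`.
[cite: BalabanImbrieJaffe1988, (5.4.3) p.282] -/
def tT (hd : 2 ≤ P.d) (ρ : ℕ → ℝ) (k j : ℕ) (b : PBond P 0) (p' : TPlaq P k) : ℝ :=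
  ∑ b₁ : PBond P j, ∑ b₂ : PBond P j,
    (hKer (P := P) ((P.eta k) ^ P.d) ((P.L : ℝ) ^ k) j b b₁ * cKer (P := P) ((P.eta k) ^ P.d) ((P.L : ℝ) ^ k) j b₁ b₂ *
        gT hd k j b₂ p' -
      hlKer (P := P) ((P.eta k) ^ P.d) ((P.L : ℝ) ^ k) (ρ j / 16) (ρ j / 8) j b b₁ *
          clKer (P := P) ((P.eta k) ^ P.d) ((P.L : ℝ) ^ k) (ρ j / 4) j b₁ b₂ *
        glT hd ρ k j b₂ p')

/-! ## §1  The local right factor `∂*Q^{e*}_k∂□`: range clause and size of the coarse curl of `□e_{b′}` -/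

variable {k : ℕ}

/-- off `b′` the 1-form `□e_{b′}` vanishes. [cite: BalabanImbrieJaffe1988, (5.4.3) p.282] -/
theorem boxSingle_of_ne (χ : PBond P k → ℝ) {b' c : PBond P k} (h : c ≠ b') : boxSingle χ b' c = 0 := if_neg h

/-- at `b′` the 1-form `□e_{b′}` is `□(b′)`. [cite: BalabanImbrieJaffe1988, (5.4.3) p.282] -/
theorem boxSingle_self (χ : PBond P k → ℝ) (b' : PBond P k) : boxSingle χ b' b' = χ b' := if_pos rfl

/-- `|□e_{b′}(c)| ≤ |□(b′)|`. [cite: BalabanImbrieJaffe1988, (5.4.3) p.282] -/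
theorem abs_boxSingle_le (χ : PBond P k → ℝ) (b' c : PBond P k) : |boxSingle χ b' c| ≤ |χ b'| := by
  unfold boxSingle
  split_ifs with h
  · rw [h]
  · rw [abs_zero]; exact abs_nonneg _

/-- `□e_{b′} = 0` when `b′ ∉ □` (`□(b′) = 0`). [cite: BalabanImbrieJaffe1988, (5.4.3) p.282] -/
theorem boxSingle_eq_zero {χ : PBond P k → ℝ} {b' : PBond P k} (h : χ b' = 0) : boxSingle χ b' = 0 := by
  funext c
  unfold boxSingle
  split_ifs with hc
  · rw [hc, h]; rfl
  · rfl

/-- the curl of the zero 1-form vanishes. [folklore] -/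
private theorem curl_zero_field {j : ℕ} (c : ℝ) : curl c (0 : PBond P j → ℝ) = 0 := by
  funext p; simp [curl]

/-- `Q^*0 = 0`. [folklore] -/
private theorem Qstar_zero_field (G : Cells) : G.Qstar 0 = 0 := by
  funext p; unfold Cells.Qstar; simp

/-- `∂^*0 = 0`. [folklore] -/
private theorem plaqDiv_zero_field {j : ℕ} (c : ℝ) : plaqDiv c (0 : TPlaq P j → ℝ) = 0 := by
  funext b; unfold plaqDiv; simp

/-- **THE RANGE CLAUSE «w′₁ = w′₁□»**, column form: for `b′ ∉ □` the column `∂^{η*}Q^{e*}_k∂(□e_{b′})` vanishes identically.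
[cite: BalabanImbrieJaffe1988, (5.4.3) p.282] -/
theorem rcol_eq_zero_of_chi (hd : 2 ≤ P.d) {χ : PBond P k → ℝ} {b' : PBond P k} (h : χ b' = 0) : rcol hd k χ b' = 0 := by
  unfold rcol
  rw [boxSingle_eq_zero h, curl_zero_field, Qstar_zero_field, plaqDiv_zero_field]

/-- a kernel applied to the zero function gives zero. [folklore] -/
private theorem applyK_zero_fun {α β : Type*} [Fintype α] (K : β → α → ℝ) (b : β) : applyK K (0 : α → ℝ) b = 0 := by
  unfold applyK; simp

/-- **THE RANGE CLAUSE «w′₁ = w′₁□; we use w′₁(b, b′) only for b in □₀ ⊂ □»**: `w′₁(b, b′) = 0` for every `η`-bond `b` whenever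
`□(b′) = 0`. [cite: BalabanImbrieJaffe1988, (5.4.3) p.282] -/
theorem w1P_eq_zero_of_chi (hd : 2 ≤ P.d) (ρ : ℕ → ℝ) {χ : PBond P k → ℝ} (b : PBond P 0) {b' : PBond P k} (h : χ b' = 0) :
    w1P hd ρ k χ b b' = 0 := by
  unfold w1P
  rw [rcol_eq_zero_of_chi hd h]
  exact applyK_zero_fun _ _

/-- `|(∂□e_{b′})(p′)| ≤ 4|□(b′)|` (four bonds, each carrying at most `|□(b′)|`). [cite: BalabanImbrieJaffe1988, (5.4.3) p.282] -/
theorem abs_curl_boxSingle_le (χ : PBond P k → ℝ) (b' : PBond P k) (p' : TPlaq P k) :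
    |curl 1 (boxSingle χ b') p'| ≤ 4 * |χ b'| := by
  simp only [curl, one_smul]
  have h1 := abs_boxSingle_le χ b' ⟨p'.src, p'.μ⟩
  have h2 := abs_boxSingle_le χ b' ⟨p'.src.shift p'.μ, p'.ν⟩
  have h3 := abs_boxSingle_le χ b' ⟨p'.src.shift p'.ν, p'.μ⟩
  have h4 := abs_boxSingle_le χ b' ⟨p'.src, p'.ν⟩
  have e1 := abs_sub (boxSingle χ b' ⟨p'.src, p'.μ⟩ + boxSingle χ b' ⟨p'.src.shift p'.μ, p'.ν⟩ -
    boxSingle χ b' ⟨p'.src.shift p'.ν, p'.μ⟩) (boxSingle χ b' ⟨p'.src, p'.ν⟩)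
  have e2 := abs_sub (boxSingle χ b' ⟨p'.src, p'.μ⟩ + boxSingle χ b' ⟨p'.src.shift p'.μ, p'.ν⟩)
    (boxSingle χ b' ⟨p'.src.shift p'.ν, p'.μ⟩)
  have e3 := abs_add_le (boxSingle χ b' ⟨p'.src, p'.μ⟩) (boxSingle χ b' ⟨p'.src.shift p'.μ, p'.ν⟩)
  linarith

/-- the curl `(∂□e_{b′})(p′)` vanishes unless `b′` is one of the four bonds of `p′`. [cite: BalabanImbrieJaffe1988, (5.4.3) p.282] -/
theorem curl_boxSingle_eq_zero (χ : PBond P k → ℝ) {b' : PBond P k} {p' : TPlaq P k}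
    (h1 : (⟨p'.src, p'.μ⟩ : PBond P k) ≠ b') (h2 : (⟨p'.src.shift p'.μ, p'.ν⟩ : PBond P k) ≠ b')
    (h3 : (⟨p'.src.shift p'.ν, p'.μ⟩ : PBond P k) ≠ b') (h4 : (⟨p'.src, p'.ν⟩ : PBond P k) ≠ b') :
    curl 1 (boxSingle χ b') p' = 0 := by
  simp only [curl, boxSingle_of_ne χ h1, boxSingle_of_ne χ h2, boxSingle_of_ne χ h3, boxSingle_of_ne χ h4]
  simp

/-- at most `d` unit plaquettes have a given bond as their `⟨x, x+e_μ⟩` edge. [folklore] -/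
private theorem card_slot1_le (b' : PBond P k) :
    (Finset.univ.filter fun p' : TPlaq P k => (⟨p'.src, p'.μ⟩ : PBond P k) = b').card ≤ P.d := by
  classical
  obtain ⟨z, κ⟩ := b'
  have h := Finset.card_le_card_of_injOn (fun p' : TPlaq P k => p'.ν) (fun p' _ => Finset.mem_univ _)
    (s := Finset.univ.filter fun p' : TPlaq P k => (⟨p'.src, p'.μ⟩ : PBond P k) = ⟨z, κ⟩) (t := (Finset.univ : Finset (Fin P.d))) ?_
  · simpa using h
  · intro p hp q hq hν
    simp only [Finset.coe_filter, Finset.mem_univ, true_and, Set.mem_setOf_eq, PBond.mk.injEq] at hp hq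
    obtain ⟨x, μ, ν, hμν⟩ := p
    obtain ⟨y, μ', ν', hμν'⟩ := q
    simp only at hp hq hν
    obtain ⟨h1, h2⟩ := hp
    obtain ⟨h3, h4⟩ := hq
    subst h1 h2 h3 h4 hν
    rfl

/-- at most `d` unit plaquettes have a given bond as their `⟨x+e_μ, x+e_μ+e_ν⟩` edge. [folklore] -/
private theorem card_slot2_le (b' : PBond P k) :
    (Finset.univ.filter fun p' : TPlaq P k => (⟨p'.src.shift p'.μ, p'.ν⟩ : PBond P k) = b').card ≤ P.d := by
  classical
  obtain ⟨z, κ⟩ := b'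
  have h := Finset.card_le_card_of_injOn (fun p' : TPlaq P k => p'.μ) (fun p' _ => Finset.mem_univ _)
    (s := Finset.univ.filter fun p' : TPlaq P k => (⟨p'.src.shift p'.μ, p'.ν⟩ : PBond P k) = ⟨z, κ⟩)
    (t := (Finset.univ : Finset (Fin P.d))) ?_
  · simpa using h
  · intro p hp q hq hμ
    simp only [Finset.coe_filter, Finset.mem_univ, true_and, Set.mem_setOf_eq, PBond.mk.injEq] at hp hq
    obtain ⟨x, μ, ν, hμν⟩ := p
    obtain ⟨y, μ', ν', hμν'⟩ := q
    simp only at hp hq hμ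
    obtain ⟨hx, h2⟩ := hp
    obtain ⟨hy, h4⟩ := hq
    subst hμ h2 h4
    have hxy : x = y := (shiftEquiv (P := P) (j := k) μ).injective (hx.trans hy.symm)
    subst hxy
    rfl

/-- at most `d` unit plaquettes have a given bond as their `⟨x+e_ν, x+e_ν+e_μ⟩` edge. [folklore] -/
private theorem card_slot3_le (b' : PBond P k) :
    (Finset.univ.filter fun p' : TPlaq P k => (⟨p'.src.shift p'.ν, p'.μ⟩ : PBond P k) = b').card ≤ P.d := by
  classical
  obtain ⟨z, κ⟩ := b'
  have h := Finset.card_le_card_of_injOn (fun p' : TPlaq P k => p'.ν) (fun p' _ => Finset.mem_univ _)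
    (s := Finset.univ.filter fun p' : TPlaq P k => (⟨p'.src.shift p'.ν, p'.μ⟩ : PBond P k) = ⟨z, κ⟩)
    (t := (Finset.univ : Finset (Fin P.d))) ?_
  · simpa using h
  · intro p hp q hq hν
    simp only [Finset.coe_filter, Finset.mem_univ, true_and, Set.mem_setOf_eq, PBond.mk.injEq] at hp hq
    obtain ⟨x, μ, ν, hμν⟩ := p
    obtain ⟨y, μ', ν', hμν'⟩ := q
    simp only at hp hq hν
    obtain ⟨hx, h2⟩ := hp
    obtain ⟨hy, h4⟩ := hq
    subst hν h2 h4
    have hxy : x = y := (shiftEquiv (P := P) (j := k) ν).injective (hx.trans hy.symm)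
    subst hxy
    rfl

/-- at most `d` unit plaquettes have a given bond as their `⟨x, x+e_ν⟩` edge. [folklore] -/
private theorem card_slot4_le (b' : PBond P k) :
    (Finset.univ.filter fun p' : TPlaq P k => (⟨p'.src, p'.ν⟩ : PBond P k) = b').card ≤ P.d := by
  classical
  obtain ⟨z, κ⟩ := b'
  have h := Finset.card_le_card_of_injOn (fun p' : TPlaq P k => p'.μ) (fun p' _ => Finset.mem_univ _)
    (s := Finset.univ.filter fun p' : TPlaq P k => (⟨p'.src, p'.ν⟩ : PBond P k) = ⟨z, κ⟩) (t := (Finset.univ : Finset (Fin P.d))) ?_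
  · simpa using h
  · intro p hp q hq hμ
    simp only [Finset.coe_filter, Finset.mem_univ, true_and, Set.mem_setOf_eq, PBond.mk.injEq] at hp hq
    obtain ⟨x, μ, ν, hμν⟩ := p
    obtain ⟨y, μ', ν', hμν'⟩ := q
    simp only at hp hq hμ
    obtain ⟨h1, h2⟩ := hp
    obtain ⟨h3, h4⟩ := hq
    subst h1 h2 h3 h4 hμ
    rfl

/-- a slot sum: `Σ_{p′} |□e_{b′}(s(p′))|·w(p′) ≤ |□(b′)|·W·#{p′ : s(p′) = b′}` for weights `0 ≤ w ≤ W` on that set. [folklore] -/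
private theorem sum_slot_le (χ : PBond P k → ℝ) (b' : PBond P k) (s : TPlaq P k → PBond P k) {w : TPlaq P k → ℝ} {W : ℝ}
    (hW : ∀ p', s p' = b' → w p' ≤ W) :
    ∑ p' : TPlaq P k, |boxSingle χ b' (s p')| * w p' ≤
      |χ b'| * W * ((Finset.univ.filter fun p' : TPlaq P k => s p' = b').card : ℝ) := by
  classical
  have hsplit : ∑ p' : TPlaq P k, |boxSingle χ b' (s p')| * w p' =
      ∑ p' ∈ Finset.univ.filter (fun p' : TPlaq P k => s p' = b'), |χ b'| * w p' := by
    rw [Finset.sum_filter]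
    refine Finset.sum_congr rfl fun p' _ => ?_
    split_ifs with h
    · rw [h, boxSingle_self]
    · rw [boxSingle_of_ne χ h, abs_zero, zero_mul]
  rw [hsplit]
  calc ∑ p' ∈ Finset.univ.filter (fun p' : TPlaq P k => s p' = b'), |χ b'| * w p'
      ≤ ∑ p' ∈ Finset.univ.filter (fun p' : TPlaq P k => s p' = b'), |χ b'| * W :=
        Finset.sum_le_sum fun p' hp' => mul_le_mul_of_nonneg_left (hW p' (Finset.mem_filter.1 hp').2) (abs_nonneg _)
    _ = |χ b'| * W * ((Finset.univ.filter fun p' : TPlaq P k => s p' = b').card : ℝ) := by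
        rw [Finset.sum_const, nsmul_eq_mul]; ring

/-- **THE COARSE CURL OF `□e_{b′}` AGAINST WEIGHTS**: for weights `w ≥ 0` bounded by `W ≥ 0` at every unit plaquette having `b′` as an edge,
`Σ_{p′} |(∂□e_{b′})(p′)|·w(p′) ≤ 4d·|□(b′)|·W` — at most `4d` plaquette–edge incidences of `b′`. [cite: BalabanImbrieJaffe1988, (5.4.3) p.282] -/
theorem sum_abs_curl_boxSingle_mul_le (χ : PBond P k → ℝ) (b' : PBond P k) {w : TPlaq P k → ℝ} {W : ℝ}
    (hw : ∀ p', 0 ≤ w p') (hW0 : 0 ≤ W)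
    (hW1 : ∀ p' : TPlaq P k, (⟨p'.src, p'.μ⟩ : PBond P k) = b' → w p' ≤ W)
    (hW2 : ∀ p' : TPlaq P k, (⟨p'.src.shift p'.μ, p'.ν⟩ : PBond P k) = b' → w p' ≤ W)
    (hW3 : ∀ p' : TPlaq P k, (⟨p'.src.shift p'.ν, p'.μ⟩ : PBond P k) = b' → w p' ≤ W)
    (hW4 : ∀ p' : TPlaq P k, (⟨p'.src, p'.ν⟩ : PBond P k) = b' → w p' ≤ W) :
    ∑ p' : TPlaq P k, |curl 1 (boxSingle χ b') p'| * w p' ≤ 4 * P.d * |χ b'| * W := by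
  classical
  have hpt : ∀ p' : TPlaq P k, |curl 1 (boxSingle χ b') p'| * w p' ≤
      |boxSingle χ b' ⟨p'.src, p'.μ⟩| * w p' + |boxSingle χ b' ⟨p'.src.shift p'.μ, p'.ν⟩| * w p' +
        |boxSingle χ b' ⟨p'.src.shift p'.ν, p'.μ⟩| * w p' + |boxSingle χ b' ⟨p'.src, p'.ν⟩| * w p' := by
    intro p'
    have e1 := abs_sub (boxSingle χ b' ⟨p'.src, p'.μ⟩ + boxSingle χ b' ⟨p'.src.shift p'.μ, p'.ν⟩ -
      boxSingle χ b' ⟨p'.src.shift p'.ν, p'.μ⟩) (boxSingle χ b' ⟨p'.src, p'.ν⟩)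
    have e2 := abs_sub (boxSingle χ b' ⟨p'.src, p'.μ⟩ + boxSingle χ b' ⟨p'.src.shift p'.μ, p'.ν⟩)
      (boxSingle χ b' ⟨p'.src.shift p'.ν, p'.μ⟩)
    have e3 := abs_add_le (boxSingle χ b' ⟨p'.src, p'.μ⟩) (boxSingle χ b' ⟨p'.src.shift p'.μ, p'.ν⟩)
    have hc : |curl 1 (boxSingle χ b') p'| ≤ |boxSingle χ b' ⟨p'.src, p'.μ⟩| + |boxSingle χ b' ⟨p'.src.shift p'.μ, p'.ν⟩| +
        |boxSingle χ b' ⟨p'.src.shift p'.ν, p'.μ⟩| + |boxSingle χ b' ⟨p'.src, p'.ν⟩| := by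
      simp only [curl, one_smul]; linarith
    nlinarith [hw p']
  have hs1 := sum_slot_le χ b' (fun p' : TPlaq P k => (⟨p'.src, p'.μ⟩ : PBond P k)) hW1
  have hs2 := sum_slot_le χ b' (fun p' : TPlaq P k => (⟨p'.src.shift p'.μ, p'.ν⟩ : PBond P k)) hW2
  have hs3 := sum_slot_le χ b' (fun p' : TPlaq P k => (⟨p'.src.shift p'.ν, p'.μ⟩ : PBond P k)) hW3
  have hs4 := sum_slot_le χ b' (fun p' : TPlaq P k => (⟨p'.src, p'.ν⟩ : PBond P k)) hW4
  have hc1 : ((Finset.univ.filter fun p' : TPlaq P k => (⟨p'.src, p'.μ⟩ : PBond P k) = b').card : ℝ) ≤ P.d := by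
    exact_mod_cast card_slot1_le b'
  have hc2 : ((Finset.univ.filter fun p' : TPlaq P k => (⟨p'.src.shift p'.μ, p'.ν⟩ : PBond P k) = b').card : ℝ) ≤ P.d := by
    exact_mod_cast card_slot2_le b'
  have hc3 : ((Finset.univ.filter fun p' : TPlaq P k => (⟨p'.src.shift p'.ν, p'.μ⟩ : PBond P k) = b').card : ℝ) ≤ P.d := by
    exact_mod_cast card_slot3_le b'
  have hc4 : ((Finset.univ.filter fun p' : TPlaq P k => (⟨p'.src, p'.ν⟩ : PBond P k) = b').card : ℝ) ≤ P.d := by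
    exact_mod_cast card_slot4_le b'
  have hX : 0 ≤ |χ b'| * W := mul_nonneg (abs_nonneg _) hW0
  calc ∑ p' : TPlaq P k, |curl 1 (boxSingle χ b') p'| * w p'
      ≤ ∑ p' : TPlaq P k, (|boxSingle χ b' ⟨p'.src, p'.μ⟩| * w p' + |boxSingle χ b' ⟨p'.src.shift p'.μ, p'.ν⟩| * w p' +
          |boxSingle χ b' ⟨p'.src.shift p'.ν, p'.μ⟩| * w p' + |boxSingle χ b' ⟨p'.src, p'.ν⟩| * w p') := Finset.sum_le_sum fun p' _ => hpt p'
    _ = ∑ p' : TPlaq P k, |boxSingle χ b' ⟨p'.src, p'.μ⟩| * w p' + ∑ p' : TPlaq P k, |boxSingle χ b' ⟨p'.src.shift p'.μ, p'.ν⟩| * w p' +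
          ∑ p' : TPlaq P k, |boxSingle χ b' ⟨p'.src.shift p'.ν, p'.μ⟩| * w p' + ∑ p' : TPlaq P k, |boxSingle χ b' ⟨p'.src, p'.ν⟩| * w p' := by
        rw [Finset.sum_add_distrib, Finset.sum_add_distrib, Finset.sum_add_distrib]
    _ ≤ |χ b'| * W * P.d + |χ b'| * W * P.d + |χ b'| * W * P.d + |χ b'| * W * P.d := by
        refine add_le_add (add_le_add (add_le_add ?_ ?_) ?_) ?_
        · exact hs1.trans (mul_le_mul_of_nonneg_left hc1 hX)
        · exact hs2.trans (mul_le_mul_of_nonneg_left hc2 hX)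
        · exact hs3.trans (mul_le_mul_of_nonneg_left hc3 hX)
        · exact hs4.trans (mul_le_mul_of_nonneg_left hc4 hX)
    _ = 4 * P.d * |χ b'| * W := by ring

/-! ## §2  `A ↦ (Q^e_k∂^ηA)(p′)` is a linear functional on fine 1-forms -/

/-- the functional `A ↦ (Q^e_k∂^ηA)(p′)` (edge average of the `η`-curl at a unit plaquette) as a linear map.
[cite: BalabanImbrieJaffe1985, (2.21) p.305] -/
def qcurl (hd : 2 ≤ P.d) (k : ℕ) (c : ℝ) (p' : TPlaq P k) : (PBond P 0 → ℝ) →ₗ[ℝ] ℝ where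
  toFun A := (edgeGeo P hd k).Q (curl c A) p'
  map_add' A B := by
    have h : curl c (A + B) = fun p => curl c A p + curl c B p := funext fun p => curl_add c A B p
    show (edgeGeo P hd k).Q (curl c (A + B)) p' = (edgeGeo P hd k).Q (curl c A) p' + (edgeGeo P hd k).Q (curl c B) p'
    rw [h]
    unfold Cells.Q
    rw [Finset.sum_add_distrib, mul_add]
  map_smul' r A := by
    have h : curl c (r • A) = fun p => r * curl c A p := funext fun p => by
      simp only [curl, Pi.smul_apply, smul_eq_mul]; ring
    show (edgeGeo P hd k).Q (curl c (r • A)) p' = r * (edgeGeo P hd k).Q (curl c A) p'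
    rw [h]
    unfold Cells.Q
    rw [← Finset.mul_sum]; ring

/-- unfolding the functional. [cite: BalabanImbrieJaffe1985, (2.21) p.305] -/
theorem qcurl_apply (hd : 2 ≤ P.d) (c : ℝ) (p' : TPlaq P k) (A : PBond P 0 → ℝ) :
    qcurl hd k c p' A = (edgeGeo P hd k).Q (curl c A) p' := rfl

/-- `G_j(b₂; p′)` is the functional at the column `H_j(·, b₂)`. [cite: BalabanImbrieJaffe1988, (5.4.3) p.282] -/
theorem gT_eq_qcurl (hd : 2 ≤ P.d) (j : ℕ) (b₂ : PBond P j) (p' : TPlaq P k) :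
    gT hd k j b₂ p' = qcurl hd k ((P.L : ℝ) ^ k) p' (fun b'' => hKer (P := P) ((P.eta k) ^ P.d) ((P.L : ℝ) ^ k) j b'' b₂) := rfl

/-- `G_{j,loc}(b₂; p′)` is the functional at the column `H_{j,loc}(·, b₂)`. [cite: BalabanImbrieJaffe1988, (5.4.3) p.282] -/
theorem glT_eq_qcurl (hd : 2 ≤ P.d) (ρ : ℕ → ℝ) (j : ℕ) (b₂ : PBond P j) (p' : TPlaq P k) :
    glT hd ρ k j b₂ p' = qcurl hd k ((P.L : ℝ) ^ k) p'
      (fun b'' => hlKer (P := P) ((P.eta k) ^ P.d) ((P.L : ℝ) ^ k) (ρ j / 16) (ρ j / 8) j b'' b₂) := rfl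

/-- **the column `b ↦ (𝒟_k − 𝒟_{k,loc})(b, ·)` as a finite linear combination of the columns `H_j(·, b₂)`, `H_{j,loc}(·, b₂)`**
(r18's `dk_sub_dkLoc_eq_sum`, function form). [cite: BalabanImbrieJaffe1988, (2.12) p.261] -/
theorem dcol_eq_sum (ρ : ℕ → ℝ) (k : ℕ) (b : PBond P 0) :
    (fun b'' : PBond P 0 => DkE P ((P.eta k) ^ P.d) ((P.L : ℝ) ^ k) k (toE P (Pi.single b'' 1)) b -
        dkLocKer (P := P) ((P.eta k) ^ P.d) ((P.L : ℝ) ^ k) ρ k b b'') =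
      ∑ j ∈ Finset.range k, ∑ b₁ : PBond P j, ∑ b₂ : PBond P j,
        ((hKer (P := P) ((P.eta k) ^ P.d) ((P.L : ℝ) ^ k) j b b₁ * cKer (P := P) ((P.eta k) ^ P.d) ((P.L : ℝ) ^ k) j b₁ b₂) •
            (fun b'' : PBond P 0 => hKer (P := P) ((P.eta k) ^ P.d) ((P.L : ℝ) ^ k) j b'' b₂) -
          (hlKer (P := P) ((P.eta k) ^ P.d) ((P.L : ℝ) ^ k) (ρ j / 16) (ρ j / 8) j b b₁ *
              clKer (P := P) ((P.eta k) ^ P.d) ((P.L : ℝ) ^ k) (ρ j / 4) j b₁ b₂) •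
            (fun b'' : PBond P 0 => hlKer (P := P) ((P.eta k) ^ P.d) ((P.L : ℝ) ^ k) (ρ j / 16) (ρ j / 8) j b'' b₂)) := by
  funext b''
  rw [dk_sub_dkLoc_eq_sum]
  simp only [Finset.sum_apply, Pi.sub_apply, Pi.smul_apply, smul_eq_mul]

/-- **`(Q^e_k∂^η[(𝒟_k − 𝒟_{k,loc})(b, ·)])(p′) = Σ_{j<k} T_j(b, p′)`** (linearity of `Q^e_k∂^η`). [cite: BalabanImbrieJaffe1988, (5.4.3) p.282] -/
theorem qcurl_dcol_eq_sum_tT (hd : 2 ≤ P.d) (ρ : ℕ → ℝ) (k : ℕ) (b : PBond P 0) (p' : TPlaq P k) :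
    (edgeGeo P hd k).Q (curl ((P.L : ℝ) ^ k) (fun b'' : PBond P 0 =>
        DkE P ((P.eta k) ^ P.d) ((P.L : ℝ) ^ k) k (toE P (Pi.single b'' 1)) b -
          dkLocKer (P := P) ((P.eta k) ^ P.d) ((P.L : ℝ) ^ k) ρ k b b'')) p' =
      ∑ j ∈ Finset.range k, tT hd ρ k j b p' := by
  rw [← qcurl_apply hd ((P.L : ℝ) ^ k) p', dcol_eq_sum ρ k b, map_sum]
  refine Finset.sum_congr rfl fun j _ => ?_
  rw [map_sum]
  unfold tT
  refine Finset.sum_congr rfl fun b₁ _ => ?_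
  rw [map_sum]
  refine Finset.sum_congr rfl fun b₂ _ => ?_
  rw [map_sub, map_smul, map_smul, smul_eq_mul, smul_eq_mul, gT_eq_qcurl, glT_eq_qcurl]

/-! ## §3  The exact reduction: `w′₁(b, b′) = Σ_{p′} (∂□e_{b′})(p′)·Σ_{j<k} T_j(b, p′)` -/

/-- **THE WEIGHTS CANCEL EXACTLY**: `η_k^d·(L^k)^d = 1` — the `η^d` of the operator convention against the `(L^k)^d` of the coarse pairing in
`⟨Q^e_kf, g⟩_{L^k} = ⟨f, Q^{e*}_kg⟩₁` (inside which `Q^{e*}_k` carries `L^{2k}` and `Q^e_k` carries `(L^k)^{−(d−2)}`).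
[cite: BalabanImbrieJaffe1985, (2.24) p.305] -/
theorem eta_pow_mul_L_pow (hd : 2 ≤ P.d) (k : ℕ) : (P.eta k) ^ P.d * (((edgeGeo P hd k).L : ℕ) : ℝ) ^ (edgeGeo P hd k).d = 1 := by
  show (P.eta k) ^ P.d * ((P.L ^ k : ℕ) : ℝ) ^ P.d = 1
  rw [Params.eta, Nat.cast_pow, ← mul_pow, inv_pow, inv_mul_cancel₀ (pow_ne_zero _ P.cast_L_pos.ne'), one_pow]

/-- step 1: the operator convention unfolded, `w′₁(b,b′) = η^dΣ_{b″}(𝒟_k − 𝒟_{k,loc})(b,b″)(∂^{η*}Q^{e*}_k∂□e_{b′})(b″)`.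
[cite: BalabanImbrieJaffe1988, (5.4.3) p.282] -/
theorem w1P_eq_weighted_sum (hd : 2 ≤ P.d) (ρ : ℕ → ℝ) (χ : PBond P k → ℝ) (b : PBond P 0) (b' : PBond P k) :
    w1P hd ρ k χ b b' = (P.eta k) ^ P.d * ∑ b'' : PBond P 0,
      (DkE P ((P.eta k) ^ P.d) ((P.L : ℝ) ^ k) k (toE P (Pi.single b'' 1)) b -
          dkLocKer (P := P) ((P.eta k) ^ P.d) ((P.L : ℝ) ^ k) ρ k b b'') * rcol hd k χ b' b'' := by
  unfold w1P applyK kdiff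
  rw [Finset.mul_sum]
  exact Finset.sum_congr rfl fun b'' _ => by ring

/-- step 2: `∂^{η*}` moved onto the kernel (`Σ_{b″}A(b″)(∂^{η*}F)(b″) = Σ_p(∂^ηA)(p)F(p)`, BIJ85Eq531Proof's `sum_curl_mul`).
[cite: BalabanImbrieJaffe1985, (4.2.2) p.310] -/
theorem sum_dcol_rcol_eq (hd : 2 ≤ P.d) (ρ : ℕ → ℝ) (χ : PBond P k → ℝ) (b : PBond P 0) (b' : PBond P k) :
    ∑ b'' : PBond P 0, (DkE P ((P.eta k) ^ P.d) ((P.L : ℝ) ^ k) k (toE P (Pi.single b'' 1)) b -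
        dkLocKer (P := P) ((P.eta k) ^ P.d) ((P.L : ℝ) ^ k) ρ k b b'') * rcol hd k χ b' b'' =
      ∑ p : TPlaq P 0, curl ((P.L : ℝ) ^ k) (fun b'' : PBond P 0 =>
          DkE P ((P.eta k) ^ P.d) ((P.L : ℝ) ^ k) k (toE P (Pi.single b'' 1)) b -
            dkLocKer (P := P) ((P.eta k) ^ P.d) ((P.L : ℝ) ^ k) ρ k b b'') p *
        (edgeGeo P hd k).Qstar (curl 1 (boxSingle χ b')) p := by
  unfold rcol
  exact (sum_curl_mul ((P.L : ℝ) ^ k) (fun b'' : PBond P 0 =>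
    DkE P ((P.eta k) ^ P.d) ((P.L : ℝ) ^ k) k (toE P (Pi.single b'' 1)) b -
      dkLocKer (P := P) ((P.eta k) ^ P.d) ((P.L : ℝ) ^ k) ρ k b b'') _).symm

/-- step 3: `Q^{e*}_k` moved onto the kernel (`⟨f, Q^{e*}_kg⟩₁ = ⟨Q^e_kf, g⟩_{L^k}`, BIJ85CellAverages' `inner_Q_eq_inner_Qstar`).
[cite: BalabanImbrieJaffe1985, (2.22) p.305] -/
theorem sum_mul_Qstar_eq (hd : 2 ≤ P.d) (f : TPlaq P 0 → ℝ) (g : TPlaq P k → ℝ) :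
    ∑ p : TPlaq P 0, f p * (edgeGeo P hd k).Qstar g p =
      ∑ p' : TPlaq P k, (((edgeGeo P hd k).L : ℕ) : ℝ) ^ (edgeGeo P hd k).d * (edgeGeo P hd k).Q f p' * g p' := by
  have h := (edgeGeo P hd k).inner_Q_eq_inner_Qstar f g
  unfold Cells.inner at h
  simp only [one_pow, one_mul] at h
  exact h.symm

/-- **THE EXACT REDUCTION OF `w′₁` ON THE TORUS**: for every `η`-bond `b` and unit bond `b′`,
`w′₁(b, b′) = Σ_{p′∈T₁^{(k)}} (∂□e_{b′})(p′)·Σ_{j<k} T_j(b, p′)`, `T_j(b, p′) = Σ_{b₁,b₂}[H_j(b,b₁)C^{(j),L^jη}(b₁,b₂)(Q^e_k∂^ηH_j(·,b₂))(p′) − loc]`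
— the tails of (2.12) dressed by `Q^e_k∂^η` on their right factor, read off at the (at most `4d`) unit plaquettes through `b′`; no weight is
left over (`η_k^d·L^{2k}·(L^k)^{d−2} = 1`). [cite: BalabanImbrieJaffe1988, (5.4.3) p.282] -/
theorem w1P_eq_sum (hd : 2 ≤ P.d) (ρ : ℕ → ℝ) (χ : PBond P k → ℝ) (b : PBond P 0) (b' : PBond P k) :
    w1P hd ρ k χ b b' = ∑ p' : TPlaq P k, curl 1 (boxSingle χ b') p' * ∑ j ∈ Finset.range k, tT hd ρ k j b p' := by
  rw [w1P_eq_weighted_sum, sum_dcol_rcol_eq, sum_mul_Qstar_eq, Finset.mul_sum]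
  refine Finset.sum_congr rfl fun p' _ => ?_
  rw [qcurl_dcol_eq_sum_tT hd ρ k b p']
  have hw := eta_pow_mul_L_pow (P := P) hd k
  calc (P.eta k) ^ P.d * ((((edgeGeo P hd k).L : ℕ) : ℝ) ^ (edgeGeo P hd k).d * (∑ j ∈ Finset.range k, tT hd ρ k j b p') *
          curl 1 (boxSingle χ b') p')
      = ((P.eta k) ^ P.d * (((edgeGeo P hd k).L : ℕ) : ℝ) ^ (edgeGeo P hd k).d) * (∑ j ∈ Finset.range k, tT hd ρ k j b p') *
          curl 1 (boxSingle χ b') p' := by ring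
    _ = curl 1 (boxSingle χ b') p' * ∑ j ∈ Finset.range k, tT hd ρ k j b p' := by rw [hw, one_mul, mul_comm]

/-- **COROLLARY (the shape used for the bound)**: `|w′₁(b, b′)| ≤ Σ_{p′} |(∂□e_{b′})(p′)|·|Σ_{j<k} T_j(b, p′)|`.
[cite: BalabanImbrieJaffe1988, (5.4.3) p.282] -/
theorem abs_w1P_le_sum (hd : 2 ≤ P.d) (ρ : ℕ → ℝ) (χ : PBond P k → ℝ) (b : PBond P 0) (b' : PBond P k) :
    |w1P hd ρ k χ b b'| ≤ ∑ p' : TPlaq P k, |curl 1 (boxSingle χ b') p'| * |∑ j ∈ Finset.range k, tT hd ρ k j b p'| := by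
  rw [w1P_eq_sum]
  refine (Finset.abs_sum_le_sum_abs _ _).trans (Finset.sum_le_sum fun p' _ => ?_)
  rw [abs_mul]

/-- **`T_j(b, p′)` UNFOLDED TO THE FACE**: `G_j(b₂; p′) = (L^k)^{−(d−2)}Σ_{p∈B^e_k(p′)}(∂^ηH_j(·,b₂))(p)` ((I.2.21) at block size `L^k`).
[cite: BalabanImbrieJaffe1985, (2.21) p.305] -/
theorem gT_eq_face_sum (hd : 2 ≤ P.d) (j : ℕ) (b₂ : PBond P j) (p' : TPlaq P k) :
    gT hd k j b₂ p' = (((P.L : ℝ) ^ k) ^ (P.d - 2))⁻¹ *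
      ∑ p ∈ (edgeGeo P hd k).B p', curl ((P.L : ℝ) ^ k) (fun b'' : PBond P 0 => hKer (P := P) ((P.eta k) ^ P.d) ((P.L : ℝ) ^ k) j b'' b₂) p := by
  unfold gT Cells.Q
  congr 2
  show ((P.L ^ k : ℕ) : ℝ) ^ (P.d - 2) = ((P.L : ℝ) ^ k) ^ (P.d - 2)
  rw [Nat.cast_pow]

/-- the same for `G_{j,loc}`. [cite: BalabanImbrieJaffe1985, (2.21) p.305] -/
theorem glT_eq_face_sum (hd : 2 ≤ P.d) (ρ : ℕ → ℝ) (j : ℕ) (b₂ : PBond P j) (p' : TPlaq P k) :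
    glT hd ρ k j b₂ p' = (((P.L : ℝ) ^ k) ^ (P.d - 2))⁻¹ *
      ∑ p ∈ (edgeGeo P hd k).B p', curl ((P.L : ℝ) ^ k)
        (fun b'' : PBond P 0 => hlKer (P := P) ((P.eta k) ^ P.d) ((P.L : ℝ) ^ k) (ρ j / 16) (ρ j / 8) j b'' b₂) p := by
  unfold glT Cells.Q
  congr 2
  show ((P.L ^ k : ℕ) : ℝ) ^ (P.d - 2) = ((P.L : ℝ) ^ k) ^ (P.d - 2)
  rw [Nat.cast_pow]

/-- **`T_j(b, p′)` AS A FACE AVERAGE OF UNDRESSED TRIPLES**: `T_j(b,p′) = (L^k)^{−(d−2)}Σ_{p∈B^e_k(p′)}Σ_{b₁,b₂}[H_j(b,b₁)C^{(j)}(b₁,b₂)(∂^ηH_j(·,b₂))(p)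
− H_{j,loc}(b,b₁)C^{(j)}_{loc}(b₁,b₂)(∂^ηH_{j,loc}(·,b₂))(p)]` — the form bounded face-plaquette by face-plaquette in the sequel.
[cite: BalabanImbrieJaffe1988, (5.4.3) p.282] -/
theorem tT_eq_face_sum (hd : 2 ≤ P.d) (ρ : ℕ → ℝ) (j : ℕ) (b : PBond P 0) (p' : TPlaq P k) :
    tT hd ρ k j b p' = (((P.L : ℝ) ^ k) ^ (P.d - 2))⁻¹ * ∑ p ∈ (edgeGeo P hd k).B p', ∑ b₁ : PBond P j, ∑ b₂ : PBond P j,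
      (hKer (P := P) ((P.eta k) ^ P.d) ((P.L : ℝ) ^ k) j b b₁ * cKer (P := P) ((P.eta k) ^ P.d) ((P.L : ℝ) ^ k) j b₁ b₂ *
          curl ((P.L : ℝ) ^ k) (fun b'' : PBond P 0 => hKer (P := P) ((P.eta k) ^ P.d) ((P.L : ℝ) ^ k) j b'' b₂) p -
        hlKer (P := P) ((P.eta k) ^ P.d) ((P.L : ℝ) ^ k) (ρ j / 16) (ρ j / 8) j b b₁ *
            clKer (P := P) ((P.eta k) ^ P.d) ((P.L : ℝ) ^ k) (ρ j / 4) j b₁ b₂ *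
          curl ((P.L : ℝ) ^ k)
            (fun b'' : PBond P 0 => hlKer (P := P) ((P.eta k) ^ P.d) ((P.L : ℝ) ^ k) (ρ j / 16) (ρ j / 8) j b'' b₂) p) := by
  unfold tT
  simp only [gT_eq_face_sum, glT_eq_face_sum]
  set C : ℝ := (((P.L : ℝ) ^ k) ^ (P.d - 2))⁻¹
  calc _ = ∑ b₁ : PBond P j, ∑ b₂ : PBond P j, ∑ p ∈ (edgeGeo P hd k).B p', C *
        (hKer (P := P) ((P.eta k) ^ P.d) ((P.L : ℝ) ^ k) j b b₁ * cKer (P := P) ((P.eta k) ^ P.d) ((P.L : ℝ) ^ k) j b₁ b₂ *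
            curl ((P.L : ℝ) ^ k) (fun b'' : PBond P 0 => hKer (P := P) ((P.eta k) ^ P.d) ((P.L : ℝ) ^ k) j b'' b₂) p -
          hlKer (P := P) ((P.eta k) ^ P.d) ((P.L : ℝ) ^ k) (ρ j / 16) (ρ j / 8) j b b₁ *
              clKer (P := P) ((P.eta k) ^ P.d) ((P.L : ℝ) ^ k) (ρ j / 4) j b₁ b₂ *
            curl ((P.L : ℝ) ^ k)
              (fun b'' : PBond P 0 => hlKer (P := P) ((P.eta k) ^ P.d) ((P.L : ℝ) ^ k) (ρ j / 16) (ρ j / 8) j b'' b₂) p) := by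
        refine Finset.sum_congr rfl fun b₁ _ => Finset.sum_congr rfl fun b₂ _ => ?_
        rw [Finset.mul_sum, Finset.mul_sum, Finset.mul_sum, Finset.mul_sum, ← Finset.sum_sub_distrib]
        exact Finset.sum_congr rfl fun p _ => by ring
    _ = ∑ p ∈ (edgeGeo P hd k).B p', ∑ b₁ : PBond P j, ∑ b₂ : PBond P j, C *
        (hKer (P := P) ((P.eta k) ^ P.d) ((P.L : ℝ) ^ k) j b b₁ * cKer (P := P) ((P.eta k) ^ P.d) ((P.L : ℝ) ^ k) j b₁ b₂ *
            curl ((P.L : ℝ) ^ k) (fun b'' : PBond P 0 => hKer (P := P) ((P.eta k) ^ P.d) ((P.L : ℝ) ^ k) j b'' b₂) p -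
          hlKer (P := P) ((P.eta k) ^ P.d) ((P.L : ℝ) ^ k) (ρ j / 16) (ρ j / 8) j b b₁ *
              clKer (P := P) ((P.eta k) ^ P.d) ((P.L : ℝ) ^ k) (ρ j / 4) j b₁ b₂ *
            curl ((P.L : ℝ) ^ k)
              (fun b'' : PBond P 0 => hlKer (P := P) ((P.eta k) ^ P.d) ((P.L : ℝ) ^ k) (ρ j / 16) (ρ j / 8) j b'' b₂) p) := by
        calc _ = ∑ b₁ : PBond P j, ∑ p ∈ (edgeGeo P hd k).B p', ∑ b₂ : PBond P j, C *
              (hKer (P := P) ((P.eta k) ^ P.d) ((P.L : ℝ) ^ k) j b b₁ * cKer (P := P) ((P.eta k) ^ P.d) ((P.L : ℝ) ^ k) j b₁ b₂ *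
                  curl ((P.L : ℝ) ^ k) (fun b'' : PBond P 0 => hKer (P := P) ((P.eta k) ^ P.d) ((P.L : ℝ) ^ k) j b'' b₂) p -
                hlKer (P := P) ((P.eta k) ^ P.d) ((P.L : ℝ) ^ k) (ρ j / 16) (ρ j / 8) j b b₁ *
                    clKer (P := P) ((P.eta k) ^ P.d) ((P.L : ℝ) ^ k) (ρ j / 4) j b₁ b₂ *
                  curl ((P.L : ℝ) ^ k)
                    (fun b'' : PBond P 0 => hlKer (P := P) ((P.eta k) ^ P.d) ((P.L : ℝ) ^ k) (ρ j / 16) (ρ j / 8) j b'' b₂) p) :=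
            Finset.sum_congr rfl fun b₁ _ => Finset.sum_comm
          _ = _ := Finset.sum_comm
    _ = _ := by
        rw [Finset.mul_sum]
        refine Finset.sum_congr rfl fun p _ => ?_
        rw [Finset.mul_sum]
        refine Finset.sum_congr rfl fun b₁ _ => ?_
        rw [Finset.mul_sum]

end

end Literature.MathematicalPhysics.QuantumFieldTheory.BalabanImbrieJaffe1984to88.BIJ88W1Prime543Torus
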